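import Summits.BirchSwinnertonDyer.BirchSwinnertonDyer.Theses.RamifiedHeegnerPair
import HarnessLib

/-!
# Route `RamifiedHeegnerPair`: the join `Assembly` (item stmt-BirchSwinnertonDyer-23195)

The route's assembly item (stmt-BirchSwinnertonDyer-23195)
`Summit.BirchSwinnertonDyer.BirchSwinnertonDyer.Theses.RamifiedHeegnerPair.Assembly :=
  PublishedInputGZK → RamifiedTwistSupply → GoodSupersingularAtThree → RamifiedPairUpperBound → RamifiedPairLowerBound → Summit.BirchSwinnertonDyer.WAllExclAddGssAtThree`
is, literally, the type of the route's planner-authored deciding theorem `Summit.BirchSwinnertonDyer.BirchSwinnertonDyer.Theses.RamifiedHeegnerPair.closes`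
(D-0027 §2.1; proved in the route file itself with the standard axioms, its hypotheses being the
route's items and its conclusion the route's registered leaf). Nothing is asserted here: every item of
the chain stays a hypothesis of `Assembly` itself; this file is ONE application of `closes`, closing the
bookkeeping item only. No crux of the route is advanced and BSD is not proved by this.
-/

set_option autoImplicit false
set_option linter.dupNamespace false

namespace Summit.BirchSwinnertonDyer.BirchSwinnertonDyer.Theorems

/-- **The join of route `RamifiedHeegnerPair` holds**: the route's items, taken as hypotheses in the order of the
assembly chain, imply its leaf `Summit.BirchSwinnertonDyer.WAllExclAddGssAtThree` — by the route's deciding theorem `closes`, whose type this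
literally is. [folklore] -/
theorem ramifiedHeegnerPair_assembly_proof :
    Summit.BirchSwinnertonDyer.BirchSwinnertonDyer.Theses.RamifiedHeegnerPair.Assembly := by
  -- (buildfix 2026-08-28) the route's `closes` was re-keyed (03:17Z) to `PublishedInputTwists` +
  -- `RamifiedTwistSupplyOfPub`, from which it first DERIVES the twist supply; the accepted `Assembly`
  -- statement takes `RamifiedTwistSupply` directly, so the remainder of the chain is inlined verbatim.
  intro hP hS hR hU hL W _ _ hCM hadd hsub hr
  obtain ⟨d, V, _, _, hd, hv, hsq, hC, hCMV, hss, hsum⟩ := hS W hCM hadd hsub hr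
  have hrV : V.analyticRank ≤ 1 := by omega
  have hBV : Literature.NumberTheory.EllipticCurves.BSDp V 3 := hR V hCMV hss hrV
  haveI : Finite V.sha := (hP V hrV).2
  obtain ⟨q'', hq'', hv''⟩ :=
    Literature.NumberTheory.EllipticCurves.Rank1Residual.Typed.missingPPartAt_of_bsdp V 3 hBV
  obtain ⟨q, q', hq, hq', hle⟩ := hL W V d hCM hadd hsub hd hv hsq hC hss hsum
  obtain ⟨r, r', hr1, hr1', hge⟩ := hU W V d hCM hadd hsub hd hv hsq hC hss hsum
  have e1 : q'' = q' := by exact_mod_cast hq''.symm.trans hq'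
  have e2 : r = q := by exact_mod_cast hr1.symm.trans hq
  have e3 : r' = q' := by exact_mod_cast hr1'.symm.trans hq'
  subst e1 e2 e3
  have hlow : Literature.NumberTheory.EllipticCurves.Rank1Residual.Typed.MissingLowerBoundAt W 3 :=
    ⟨r, hq, by linarith⟩
  have hup : Literature.NumberTheory.EllipticCurves.Rank1Residual.Typed.MissingUpperBoundAt W 3 :=
    ⟨r, hq, by linarith⟩
  exact Literature.NumberTheory.EllipticCurves.Rank1Residual.Typed.bsdp_of_missingPPartAt W 3 hP hr
    (Literature.NumberTheory.EllipticCurves.Rank1Residual.Typed.missingPPartAt_of_lower_of_upper W 3 hlow hup)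

end Summit.BirchSwinnertonDyer.BirchSwinnertonDyer.Theorems
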